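import Literature.AlgebraicGeometry.AbelianSchemes.RingActionCotangentMapModP          -- ★ DEAL 11 p846632: `hsig_of_one`, `cotangentMap_eq_comp_of_hom_eq`, `cotangentMap_eq_of_hom_eq_of_sub_mem_span`
import Literature.AlgebraicGeometry.AbelianSchemes.AbelianSchemeCotangentCharpoly       -- ★ D2b (A-p01 g22): `lieCharpoly`, `cotangentCharpoly`, unit-section charts over a local base
import Literature.AlgebraicGeometry.AbelianSchemes.AbelianSchemeFibreEndomorphisms      -- ★ `AbelianScheme.fibre`, `fibreEnd`, §4 the fibre square
import Literature.AlgebraicGeometry.AbelianSchemes.AbelianSchemeFixedPowBaseChange      -- ★ `AbelianSchemeOver.RingAction.baseChange`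
import Literature.AlgebraicGeometry.Motives.AbelianVarietyCotangentOfFibreEndo          -- ★ A-p03: `charpoly_cotangentMap_eq_map_charpoly`
import Literature.AlgebraicGeometry.Morphisms.FibreChartRing                            -- ★ `isAffineOpen_preimage_of_isPullback`
import Literature.LinearAlgebra.IdempotentRankOfCharpolyFactorisation                   -- ★ (S-T-A) p846710: `finrank_range_eq_one_of_charpoly_eq_prod`
import HarnessLib

/-!
# Socket (S-T) closed over a local base: the Lie signature of the `w`-block at a special point from the Kottwitz
# factorisation of `char(ι(a₁) | Lie)` over the local ring (Kottwitz 1992 §5; RSZ 2020 §4.1 (4.6); Liu 2021 p. 137)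

Topic `Literature/AlgebraicGeometry/AbelianSchemes`; namespaces `Literature.AlgebraicGeometry.AbelianSchemes.AbelianScheme` (§1) and
`Literature.AlgebraicGeometry.AbelianSchemes.AbelianSchemeOver.RingAction` (§2–§4).  THEOREMS ONLY (no definition, no named fact, no instance,
no notation, no `sorry`).  Cell `hodgecm-mathlib` (D-0151), FLOOR 0, P6 «MOD programme» (crux hLiu418 = stmt-HodgeConjecture-24832, `--supports`):
FILE 1 (FRAME-AGNOSTIC, over an arbitrary LOCAL base `R₀` with a field-valued point `φ : R₀ → κ`, LEAD M-17w (R-β)) of the junction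
**(S-T) «KOTTWITZ ⇒ LIE SIGNATURE AT x̄»** (A-p17 (g26), 2026-09-01) = the supplier of the `hsig` binder of the K∕BT desk's ED. 7 line
`Cruxes/HLiu418/Lines/F0_P6d_BlockDocking.lean` (`blockDocking_of_line` :80) in the desk's `cotangentMap` currency (★ DEAL 6
`htan_hdim_block_of_lieSignature`, ★ DEAL 11 `hsig_of_one`).

THE MATHEMATICS.  Let `𝒜 → Spec R₀` be an abelian scheme of relative dimension `g` over a LOCAL ring, `act : ι : O → End(𝒜)` a ring
action, `(p) = w^e 𝔟`, `w + 𝔟 = O`, `a_n ≡ 1 (w^{en})`, `a_n ≡ 0 (𝔟ⁿ)` a block family (★ `BlockIdempotentFamily`), and suppose the Kottwitz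
determinant condition is known over `R₀` in the factorised form `char(T, ι(a₁) | Lie(𝒜∕R₀)) = ∏_{i ∈ s} (T − c_i)^{m_i}` with roots `c_i ∈ R₀`
(★ D2b chart-free `AbelianScheme.lieCharpoly`; in print `i = τ` runs over the embeddings of `F`, `c_τ = τ(a₁)`, `m_τ = r_τ` the signature,
[Kottwitz1992] §5, [RapoportSmithlingZhang2020Diagonal] §4.1 (4.6) (4.6)).  At a field-valued point `φ : R₀ → κ` of characteristic `p` with
`Σ_{i : φ(c_i) = 1} m_i = 1` («signature `(1, n−1)` at exactly one embedding inducing the place of the block», [Liu2021] Remark C.2 p. 108, p. 137):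
(§1) `char(ι(a₁)^* | 𝔪_e∕𝔪_e²(𝒜_φ)) = (char(ι(a₁) | Lie(𝒜∕R₀)))^φ = ∏ (T − φ(c_i))^{m_i}` — the cotangent characteristic polynomial of an
`R₀`-model is ONE polynomial over `R₀` read in every fibre (★ A-p03 `charpoly_cotangentMap_eq_map_charpoly` on the fibre square ★
`AbelianScheme.isPullback_fibre`, over a unit-section chart with free `ω`, which exists over a local base ★ `exists_unitSectionChart_of_isLocalRing`);
(§3) `ι(a₁)^*` is idempotent in characteristic `p` (`a₁² ≡ a₁ (p)`, ★ `mul_self_sub_mem_span_pow`, ★ DEAL 11 `cotangentMap_eq_of_hom_eq_of_sub_mem_span`);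
(§4) so `rk ι(a₁)^* = Σ_{φ(c_i)=1} m_i = 1` (★ (S-T-A) `finrank_range_eq_one_of_charpoly_eq_prod`) and ★ DEAL 11 `hsig_of_one` gives `hsig` for
every `n ≥ 1` on `(𝒜_φ, ι_φ)` — the ED. 7 binder at `A := 𝒜.baseChange gκ`, `act := act.baseChange gκ` for ANY `gκ = Spec φ`, BY VALUE.
(§2) Conversely the factorisation over `R₀` is PINNED by any injective field point `φ_Ω : R₀ ↪ Ω` (the geometric generic point of the
valuation ring of record): `char(ι(a₁)^* | 𝔪_e∕𝔪_e²(𝒜_Ω)) = P^{φ_Ω}` ⇒ `char(ι(a₁) | Lie(𝒜∕R₀)) = P` (`Polynomial.map_injective`).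

* §1 `AbelianScheme.charpoly_cotangentMap_fibreEnd_eq_map_lieCharpoly` (affine carrier), `RingAction.charpoly_cotangentMap_baseChange_i`
  (the ED. 7 token shape: `A := 𝒜.baseChange (Spec.map φ)`, `homMk (Grp.ofHom ((act.baseChange _).i r))`).
* §2 `RingAction.lieCharpoly_i_eq_of_charpoly_cotangentMap_eq_map` (generic leg, `φ_Ω` injective).
* §3 `RingAction.isIdempotentElem_cotangentMap_i_blockIdempotent` (any field of characteristic `p`).
* §4 `RingAction.hsig_of_charpoly_cotangentMap_eq_prod` (field level: `hχ` + count ⇒ `hsig`) and the HEAD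
  **`RingAction.hsig_baseChange_of_lieCharpoly_eq_prod`** (local base: Kottwitz factorisation over `R₀` + count at `φ` ⇒ `hsig` at `φ`).

FILE 2 (`HodgeTheory/IntegralModelSpecialPointLieSignature`) instantiates `R₀ := closureValuationSubring ⊆ Ω = F̄_w` along the lift `x̃` of a
point `y ∈ Y(Ω)` of a proper model, pins the factorisation from the datum's Ω-fibre at `y` (§2 + ★ `exists_iso_fibre_generic_along_extendPoint`),
and transports `hsig` to the datum's own special fibre `sch₀Of 𝓜 w 𝒜 (red y)` (★ `exists_iso_fibre_special_along_extendPoint`).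

HC_CM is proved only modulo the printed citations (2 remaining named inputs hLiu418 24832, h413 24833) until rung 0 closes; this file is
generic and changes no count.

## References
* [Kottwitz1992] R. E. Kottwitz, *Points on some Shimura varieties over finite fields*, JAMS 5 (1992), §5 (p. 390).
* [RapoportSmithlingZhang2020Diagonal] M. Rapoport, B. Smithling, W. Zhang, *Arithmetic diagonal cycles on unitary Shimura varieties*,
  Compos. Math. 156 (2020), §4.1 (4.5)–(4.6) p. 16, (4.19) p. 19.
* [Liu2021] Y. Liu, *Fourier–Jacobi cycles and arithmetic relative trace formula*, Camb. J. Math. 9 (2021), Remark C.2 p. 108, §D.4 p. 134, p. 137.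
* [GortzWedhorn2023] U. Görtz, T. Wedhorn, *Algebraic Geometry II* (2023), Remark 17.14, Remark 17.15 (1), Def. 27.17.
* [Shimura1998] G. Shimura, *Abelian Varieties with Complex Multiplication and Modular Functions* (1998), §12.4 Prop. 26 (proof p. 109).
-/

set_option autoImplicit false

noncomputable section

-- `X.toAffine.toAbelianVariety.X = X.X`, `(A.baseChange (Spec φ)).toAffine = A.toAffine.baseChange φ` etc. are definitional only above
-- `instances` transparency (as in ★ `RingActionCotangentMapModP`, ★ `AbelianSchemeCotangentCharpolySpread`).
set_option backward.isDefEq.respectTransparency false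

universe u v

open CategoryTheory CategoryTheory.Limits AlgebraicGeometry MonoidalCategory CartesianMonoidalCategory Polynomial
open scoped MonObj

namespace Literature.AlgebraicGeometry.AbelianSchemes

open Literature.AlgebraicGeometry.Motives Literature.AlgebraicGeometry.Motives.AbelianVariety
open Literature.AlgebraicGeometry.Morphisms Literature.AlgebraicGeometry.Morphisms.ChartRing
open Literature.RingTheory.Smooth Literature.RingTheory.DedekindDomain Literature.LinearAlgebra

/-! ## §1 The cotangent characteristic polynomial of a fibre is the Lie characteristic polynomial over the local base, read at the point -/

namespace AbelianScheme

variable {R : Type u} [CommRing R] [IsLocalRing R] (𝒜 : AbelianScheme R) {g : ℕ} (h𝒜 : 𝒜.IsOfRelDim g)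
  (v : 𝒜.X ⟶ 𝒜.X) [IsMonHom v] {κ : Type u} [Field κ] (φ : R →+* κ)

/-- **`char(v_φ^* | 𝔪_e∕𝔪_e²(𝒜_φ)) = char(v | Lie(𝒜∕R))^φ`.**  For an abelian scheme `𝒜` of relative dimension `g` over a LOCAL ring `R`, a
homomorphism `v : 𝒜 → 𝒜` and a field-valued point `φ : R → κ`: the characteristic polynomial of the cotangent map of the specialised
endomorphism `v_φ` (★ `fibreEnd`) on `𝔪_e∕𝔪_e²` of the fibre `𝒜_φ` (★ `cotangentMap`) is the image under `φ` of the chart-free ★ `lieCharpoly` of `v`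
— ★ A-p03 `charpoly_cotangentMap_eq_map_charpoly` on the fibre square (★ `isPullback_fibre`, `unitPt_fibre_comp_fst`, `toSchemeHom_fibreEnd_comp_fst`)
over a unit-section chart with free finite `ω`, which exists over a local base (★ `exists_unitSectionChart_of_isLocalRing`).
[cite: GortzWedhorn2023, Remark 17.14 and Remark 17.15 (1)] [cite: Kottwitz1992, §5 (p. 390)] [cite: Shimura1998, §12.4 Prop. 26 (proof p. 109)] -/
theorem charpoly_cotangentMap_fibreEnd_eq_map_lieCharpoly :
    (cotangentMap (𝒜.fibre φ) (𝒜.fibreEnd φ v)).charpoly = (𝒜.lieCharpoly h𝒜 v (𝒜.unit_left_comp_left v)).map φ := by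
  letI : Algebra R κ := φ.toAlgebra
  obtain ⟨W, hW, heW, hfree, hfin, -⟩ := 𝒜.exists_unitSectionChart_of_isLocalRing h𝒜
  haveI := hfree
  haveI := hfin
  obtain ⟨h, hh, hhv⟩ := 𝒜.exists_shrink_unitSectionChart hW heW v (𝒜.unit_left_comp_left v)
  rw [𝒜.lieCharpoly_eq_cotangentCharpoly h𝒜 v (𝒜.unit_left_comp_left v) hW heW,
    𝒜.cotangentCharpoly_eq_charpoly_sectionConormalEndo hW heW v (𝒜.unit_left_comp_left v) h hhv hh]
  -- the fibre square of `𝒜_φ` (★ `AbelianSchemeFibreEndomorphisms` §4)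
  have hP : IsPullback (pullback.fst 𝒜.X.hom (specMap φ)) (𝒜.fibre φ).X.hom 𝒜.X.hom
      (Spec.map (CommRingCat.ofHom (algebraMap R κ))) :=
    𝒜.isPullback_fibre φ
  have horig : unitPt (𝒜.fibre φ) ≫ pullback.fst 𝒜.X.hom (specMap φ) =
      Spec.map (CommRingCat.ofHom (algebraMap R κ)) ≫ η[𝒜.X].left :=
    𝒜.unitPt_fibre_comp_fst φ
  have hU : IsAffineOpen (pullback.fst 𝒜.X.hom (specMap φ) ⁻¹ᵁ W) :=
    isAffineOpen_preimage_of_isPullback 𝒜.X.hom (pullback.fst 𝒜.X.hom (specMap φ)) (𝒜.fibre φ).X.hom hP hW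
  have heU : origin (𝒜.fibre φ) ∈ pullback.fst 𝒜.X.hom (specMap φ) ⁻¹ᵁ W :=
    origin_mem_preimage η[𝒜.X].left (𝒜.fibre φ) (pullback.fst 𝒜.X.hom (specMap φ)) horig W heW
  exact charpoly_cotangentMap_eq_map_charpoly 𝒜.X.hom η[𝒜.X].left 𝒜.unit_left_comp_hom hW heW (𝒜.fibre φ)
    (pullback.fst 𝒜.X.hom (specMap φ)) hP horig hU heU v.left (𝒜.left_comp_hom v) (𝒜.unit_left_comp_left v) (𝒜.fibreEnd φ v)
    (𝒜.toSchemeHom_fibreEnd_comp_fst φ v) h hh hhv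

end AbelianScheme

namespace AbelianSchemeOver

namespace RingAction

/-- **THE SAME IN THE ED. 7 TOKEN SHAPE** (`A := 𝒜.baseChange g` for ANY `g : Spec κ → Spec R₀` of the form `Spec φ`, the endomorphism
`homMk (Grp.ofHom ((act.baseChange g).i r))` of `A.toAffine.toAbelianVariety`): for `𝒜` over `Spec R₀`, `R₀` local, with a ring action `act`,
`char((ι_φ r)^* | 𝔪_e∕𝔪_e²) = (lieCharpoly 𝒜 (ι r))^φ`.  (`(𝒜.baseChange (Spec φ)).toAffine = 𝒜.toAffine.baseChange φ` and
`(act.baseChange _).i r = (ι r)_φ` hold on the nose.) [cite: GortzWedhorn2023, Remark 17.14 and Remark 17.15 (1)] [cite: Kottwitz1992, §5 (p. 390)] -/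
theorem charpoly_cotangentMap_baseChange_i {R : Type u} [CommRing R] [IsLocalRing R] {𝒜 : AbelianSchemeOver (Spec (.of R))}
    {n : ℕ} (h𝒜 : 𝒜.IsOfRelDim n) {O : Type v} [CommRing O] (act : RingAction O 𝒜) (r : O) {κ : Type u} [Field κ]
    (g : Spec (.of κ) ⟶ Spec (.of R)) (φ : R →+* κ) (hφ : g = Spec.map (CommRingCat.ofHom φ)) :
    (haveI := (act.baseChange g).isMonHom_i r
     (cotangentMap (𝒜.baseChange g).toAffine.toAbelianVariety
        (InducedCategory.homMk (Grp.ofHom (A := (𝒜.baseChange g).X) (B := (𝒜.baseChange g).X) ((act.baseChange g).i r)))).charpoly) =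
      (haveI := act.isMonHom_i r
       (AbelianScheme.lieCharpoly 𝒜.toAffine h𝒜 (act.i r) (𝒜.toAffine.unit_left_comp_left (act.i r))).map φ) := by
  subst hφ
  haveI := act.isMonHom_i r
  exact AbelianScheme.charpoly_cotangentMap_fibreEnd_eq_map_lieCharpoly 𝒜.toAffine h𝒜 (act.i r) φ

/-! ## §2 The generic leg: an injective field point pins the Lie characteristic polynomial over the base -/

/-- **An injective field-valued point `φ_Ω : R₀ ↪ Ω` PINS `char(ι(r) | Lie(𝒜∕R₀))`**: if `char((ι_Ω r)^* | 𝔪_e∕𝔪_e²(𝒜_Ω)) = P^{φ_Ω}` for some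
`P ∈ R₀[T]` then `lieCharpoly 𝒜 (ι r) = P` (§1 and `Polynomial.map_injective`).  In the use: `R₀` the valuation ring of `Ω = F̄_w`, `P` the Kottwitz
polynomial `∏_τ (T − τ(a₁))^{r_τ}` whose roots are integral. [cite: Kottwitz1992, §5 (p. 390)] [cite: GortzWedhorn2023, Remark 17.15 (1)] -/
theorem lieCharpoly_i_eq_of_charpoly_cotangentMap_eq_map {R : Type u} [CommRing R] [IsLocalRing R] {𝒜 : AbelianSchemeOver (Spec (.of R))}
    {n : ℕ} (h𝒜 : 𝒜.IsOfRelDim n) {O : Type v} [CommRing O] (act : RingAction O 𝒜) (r : O) {Ω : Type u} [Field Ω]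
    (g : Spec (.of Ω) ⟶ Spec (.of R)) (φ : R →+* Ω) (hφ : g = Spec.map (CommRingCat.ofHom φ)) (hinj : Function.Injective φ) (P : R[X])
    (hK : haveI := (act.baseChange g).isMonHom_i r
      (cotangentMap (𝒜.baseChange g).toAffine.toAbelianVariety
        (InducedCategory.homMk (Grp.ofHom (A := (𝒜.baseChange g).X) (B := (𝒜.baseChange g).X) ((act.baseChange g).i r)))).charpoly =
      P.map φ) :
    haveI := act.isMonHom_i r
    AbelianScheme.lieCharpoly 𝒜.toAffine h𝒜 (act.i r) (𝒜.toAffine.unit_left_comp_left (act.i r)) = P :=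
  Polynomial.map_injective φ hinj ((act.charpoly_cotangentMap_baseChange_i h𝒜 r g φ hφ).symm.trans hK)

/-! ## §3 In characteristic `p`, `ι(a₁)^*` is idempotent on `𝔪_e∕𝔪_e²` -/

variable {k : Type u} [Field k] {𝒜 : AbelianSchemeOver (Spec (.of k))} {O : Type v} [CommRing O] (act : RingAction O 𝒜)
  {p : ℕ} {w 𝔟 : Ideal O} {e : ℕ} (hx : Ideal.span {(p : O)} = w ^ e * 𝔟) (hcop : w ⊔ 𝔟 = ⊤)
  (a : ℕ → O) (ha1 : ∀ n, a n - 1 ∈ w ^ (e * n)) (ha2 : ∀ n, a n ∈ 𝔟 ^ n)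

include hx hcop ha1 ha2 in
/-- **`ι(a₁)^*` IS IDEMPOTENT on `𝔪_e∕𝔪_e²` in characteristic `p`**: `(ι(a₁)^*)² = ι(a₁²)^*` (★ DEAL 11 `cotangentMap_eq_comp_of_hom_eq`) and
`a₁² ≡ a₁ (mod p)` (★ `mul_self_sub_mem_span_pow … 1`) so `ι(a₁²)^* = ι(a₁)^*` (★ DEAL 11 `cotangentMap_eq_of_hom_eq_of_sub_mem_span`) — the
hypothesis `hE` of ★ (S-T-A) `finrank_range_eq_one_of_charpoly_eq_prod`. [cite: Kottwitz1992, §5 (p. 390)] [cite: GortzWedhorn2023, Remark 27.18 (3)] -/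
theorem isIdempotentElem_cotangentMap_i_blockIdempotent [IsCommMonObj 𝒜.X] [CharP k p] :
    IsIdempotentElem (haveI := act.isMonHom_i (a 1)
      cotangentMap 𝒜.toAffine.toAbelianVariety (InducedCategory.homMk (Grp.ofHom (A := 𝒜.X) (B := 𝒜.X) (act.i (a 1))))) := by
  haveI := act.isMonHom_i (a 1)
  haveI := act.isMonHom_i (a 1 * a 1)
  have e1 := act.cotangentMap_eq_comp_of_hom_eq (c := a 1) (d := a 1)
    (u := InducedCategory.homMk (Grp.ofHom (A := 𝒜.X) (B := 𝒜.X) (act.i (a 1))))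
    (v := InducedCategory.homMk (Grp.ofHom (A := 𝒜.X) (B := 𝒜.X) (act.i (a 1))))
    (w := InducedCategory.homMk (Grp.ofHom (A := 𝒜.X) (B := 𝒜.X) (act.i (a 1 * a 1)))) rfl rfl rfl
  have hmem : a 1 * a 1 - a 1 ∈ Ideal.span {(p : O)} := by
    have h := mul_self_sub_mem_span_pow hx hcop ha1 ha2 1
    rwa [pow_one] at h
  have e2 := act.cotangentMap_eq_of_hom_eq_of_sub_mem_span hmem
    (u := InducedCategory.homMk (Grp.ofHom (A := 𝒜.X) (B := 𝒜.X) (act.i (a 1 * a 1))))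
    (v := InducedCategory.homMk (Grp.ofHom (A := 𝒜.X) (B := 𝒜.X) (act.i (a 1)))) rfl rfl
  change _ * _ = _
  rw [Module.End.mul_eq_comp, ← e1, e2]

/-! ## §4 Socket (S-T): `hsig` from a Kottwitz factorisation and the count `Σ_{c_i = 1} m_i = 1` -/

include hx hcop ha1 ha2 in
/-- **`hsig` AT A FIELD POINT FROM `hχ` AND THE COUNT**: if `char(ι(a₁)^* | 𝔪_e∕𝔪_e²) = ∏_{i∈s} (T − c_i)^{m_i}` over `k` (characteristic `p`) with
`Σ_{i : c_i = 1} m_i = 1`, then the ED. 7 binder `hsig` holds for every `n ≥ 1` (§3 + ★ (S-T-A) `finrank_range_eq_one_of_charpoly_eq_prod` + ★ DEAL 11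
`hsig_of_one`). [cite: RapoportSmithlingZhang2020Diagonal, §4.1 (4.6) p. 16 and (4.19) p. 19] [cite: Liu2021, Remark C.2 p. 108; p. 137] [cite: Kottwitz1992, §5 (p. 390)] -/
theorem hsig_of_charpoly_cotangentMap_eq_prod [IsCommMonObj 𝒜.X] [CharP k p] [DecidableEq k] {σ : Type*} [DecidableEq σ]
    (s : Finset σ) (c : σ → k) (m : σ → ℕ)
    (hχ : haveI := act.isMonHom_i (a 1)
      (cotangentMap 𝒜.toAffine.toAbelianVariety (InducedCategory.homMk (Grp.ofHom (A := 𝒜.X) (B := 𝒜.X) (act.i (a 1))))).charpoly =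
        ∏ i ∈ s, (Polynomial.X - C (c i)) ^ m i)
    (h1 : ∑ i ∈ s with c i = 1, m i = 1) :
    ∀ n, 0 < n → haveI := act.isMonHom_i (a n)
      Module.finrank k (LinearMap.range (cotangentMap 𝒜.toAffine.toAbelianVariety
        (InducedCategory.homMk (Grp.ofHom (A := 𝒜.X) (B := 𝒜.X) (act.i (a n)))))) = 1 :=
  act.hsig_of_one hx hcop a ha1 ha2
    (finrank_range_eq_one_of_charpoly_eq_prod (act.isIdempotentElem_cotangentMap_i_blockIdempotent hx hcop a ha1 ha2) s c m hχ h1)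

/-- **HEAD — SOCKET (S-T) OVER A LOCAL BASE.**  `𝒜 → Spec R₀` an abelian scheme of relative dimension `g` over a LOCAL ring with a ring
action `act` of `O`, `(p) = w^e 𝔟`, `w + 𝔟 = O`, `(a_n)` a block family; KOTTWITZ over `R₀`: `char(T, ι(a₁) | Lie(𝒜∕R₀)) = ∏_{i∈s} (T − c_i)^{m_i}` with
`c_i ∈ R₀` (★ chart-free `lieCharpoly`); `φ : R₀ → κ` a field-valued point of characteristic `p` with the COUNT `Σ_{i : φ(c_i) = 1} m_i = 1`.  Then for
every `n ≥ 1` the cotangent map of `ι_φ(a_n)` on `𝔪_e∕𝔪_e²(𝒜_φ)` has rank `1` — the `hsig` binder of ED. 7 `F0P6dBlockDocking.blockDocking_of_line` at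
`A := 𝒜.baseChange (Spec φ)`, `act := act.baseChange (Spec φ)`, BY VALUE (§1 reads `hχ` at `φ`, then `hsig_of_charpoly_cotangentMap_eq_prod`).
«The `w`-component of `Lie A` is a line: signature `(1, n−1)` at `w`.» [cite: RapoportSmithlingZhang2020Diagonal, §4.1 (4.6) p. 16 and (4.19) p. 19] [cite: Liu2021, Remark C.2 p. 108; p. 137]
[cite: Kottwitz1992, §5 (p. 390)] -/
theorem hsig_baseChange_of_lieCharpoly_eq_prod {R : Type u} [CommRing R] [IsLocalRing R] {𝒜 : AbelianSchemeOver (Spec (.of R))}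
    {g : ℕ} (h𝒜 : 𝒜.IsOfRelDim g) {O : Type v} [CommRing O] (act : RingAction O 𝒜)
    {p : ℕ} {w 𝔟 : Ideal O} {e : ℕ} (hx : Ideal.span {(p : O)} = w ^ e * 𝔟) (hcop : w ⊔ 𝔟 = ⊤)
    (a : ℕ → O) (ha1 : ∀ n, a n - 1 ∈ w ^ (e * n)) (ha2 : ∀ n, a n ∈ 𝔟 ^ n)
    {σ : Type*} [DecidableEq σ] (s : Finset σ) (c : σ → R) (m : σ → ℕ)
    (hK : haveI := act.isMonHom_i (a 1)
      AbelianScheme.lieCharpoly 𝒜.toAffine h𝒜 (act.i (a 1)) (𝒜.toAffine.unit_left_comp_left (act.i (a 1))) = ∏ i ∈ s, (Polynomial.X - C (c i)) ^ m i)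
    {κ : Type u} [Field κ] [DecidableEq κ] [CharP κ p] (gκ : Spec (.of κ) ⟶ Spec (.of R)) (φ : R →+* κ)
    (hφ : gκ = Spec.map (CommRingCat.ofHom φ)) [IsCommMonObj (𝒜.baseChange gκ).X] (h1 : ∑ i ∈ s with φ (c i) = 1, m i = 1) :
    ∀ n, 0 < n → haveI := (act.baseChange gκ).isMonHom_i (a n)
      Module.finrank κ (LinearMap.range (cotangentMap (𝒜.baseChange gκ).toAffine.toAbelianVariety
        (InducedCategory.homMk (Grp.ofHom (A := (𝒜.baseChange gκ).X) (B := (𝒜.baseChange gκ).X) ((act.baseChange gκ).i (a n)))))) = 1 := by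
  have hχ := act.charpoly_cotangentMap_baseChange_i h𝒜 (a 1) gκ φ hφ
  rw [hK, Polynomial.map_prod] at hχ
  simp only [Polynomial.map_pow, Polynomial.map_sub, Polynomial.map_X, Polynomial.map_C] at hχ
  exact (act.baseChange gκ).hsig_of_charpoly_cotangentMap_eq_prod hx hcop a ha1 ha2 s (fun i => φ (c i)) m hχ h1

end RingAction

end AbelianSchemeOver

end Literature.AlgebraicGeometry.AbelianSchemes

end
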